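import Summits.Ventures.CertifiedArithmetic.Expansions.DyadicValuation
import Mathlib.Tactic.Linarith
import Mathlib.Tactic.Positivity
import Mathlib.Tactic.Ring
import Mathlib.Tactic.NormNum

/-!
# COMPRESS, termination: the potential and the half-ulp slack (new work)

New work of the certified-arithmetic venture (ENGINES group: shared numerical engines serving
client cells; rigour lives in the verifiers; every published number belongs to a client cell's
ledger, not to the engines group).  [Shewchuk1997, Thm 23] is about ONE pass of COMPRESS
(§2.7, Fig. 11) and the paper does not discuss iterating it; `CompressPassesUnbounded*.lean`
showed that the number of list-changing passes is unbounded.  `CompressValuationSweeps.lean` and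
`CompressTerminates.lean` prove the matching upper bound: every list-changing pass strictly lowers
the POTENTIAL `valPot emin e = Σ_{x ∈ e} (v x − emin)` (`v` the 2-adic valuation), so the iteration
reaches its fixed point.

Here, the bookkeeping both sweeps share: the potential; the HALF-ULP SLACK predicates `DownSlack`
(largest first) / `UpSlack` (smallest first) — below every output component `g` with a full odd
significand the lower components sum to less than `ulp(g)/2 − 2^(v a − 1)`, `a` the component
directly below — with the passage from the downward to the upward form; and two valuation forms of
Shewchuk's nonadjacency bounds.  Only definitions and elementary lemmas; the sweeps are in
`CompressValuationSweeps.lean`.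

References: J. R. Shewchuk, Discrete Comput. Geom. 18 (1997) 305–363, §2.1, §2.7 and Thm 23
[Shewchuk1997]; S. Boldo, C.-P. Jeannerod, G. Melquiond, J.-M. Muller, Acta Numerica 32 (2023),
§2.1 [BoldoEtAl2023].
-/

namespace Summit.Ventures.CertifiedArithmetic.Expansions

open Literature.ComputerArithmetic.JeannerodRump2018
open Literature.ComputerArithmetic.BoldoJeannerodMelquiondMuller2023 hiding twoSum twoSum_fst
open Literature.ComputerArithmetic.Shewchuk1997

variable {p : ℕ} {emin : ℤ} {fl : ℚ → ℚ}

/-! ### The potential and the half-ulp slack -/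

/-- THE POTENTIAL of a list of components on the grid `2^emin`: the sum of the 2-adic valuations
of the components, each counted from `emin`.  Every list-changing pass of COMPRESS lowers it. -/
def valPot (emin : ℤ) (l : List ℚ) : ℤ := (l.map fun x => padicValRat 2 x - emin).sum

/-- Unfolding. -/
@[simp] theorem valPot_nil (emin : ℤ) : valPot emin [] = 0 := by simp [valPot]

/-- Unfolding. -/
@[simp] theorem valPot_cons (emin : ℤ) (x : ℚ) (l : List ℚ) :
    valPot emin (x :: l) = padicValRat 2 x - emin + valPot emin l := by simp [valPot]

/-- The potential is additive. -/
theorem valPot_append (emin : ℤ) (l l' : List ℚ) :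
    valPot emin (l ++ l') = valPot emin l + valPot emin l' := by simp [valPot]

/-- The potential does not see the order of the components. -/
theorem valPot_reverse (emin : ℤ) (l : List ℚ) : valPot emin l.reverse = valPot emin l := by
  simp [valPot, List.map_reverse, List.sum_reverse]

/-- The potential of a list of NONZERO floats is a natural number. -/
theorem valPot_nonneg {l : List ℚ} (hl : ∀ x ∈ l, IsFloat p emin x) (hne : ∀ x ∈ l, x ≠ 0) :
    0 ≤ valPot emin l := by
  induction l with
  | nil => simp
  | cons x l ih =>
    rw [valPot_cons]
    have h1 := emin_le_padicValRat_two (hl x (by simp)) (hne x (by simp))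
    have h2 := ih (fun y hy => hl y (List.mem_cons_of_mem _ hy))
      (fun y hy => hne y (List.mem_cons_of_mem _ hy))
    omega

/-- HALF-ULP SLACK, largest component first: below every component `g` whose significand is
full and odd (`ulp g = 2^k`, `g ∉ 2^(k+1)·ℤ`) the remaining components sum to less than
`2^k / 2 − 2^(v a − 1)`, `a` being the component directly below `g`.  The downward sweep
delivers it; it is what lets such a `g` absorb the carry of the upward sweep unchanged. -/
def DownSlack (p : ℕ) (emin : ℤ) : List ℚ → Prop
  | [] => True
  | g :: rest => (∀ a ∈ rest.head?, ∀ k : ℤ, ulp p emin g = (2 : ℚ) ^ k →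
      ¬ OnGrid (k + 1) g → |rest.sum| < (2 : ℚ) ^ k / 2 - (2 : ℚ) ^ (padicValRat 2 a - 1)) ∧
    DownSlack p emin rest

/-- HALF-ULP SLACK, smallest component first, relative to the exact sum `S` of everything already
passed and to the valuation level `m` of the component passed last. -/
def UpSlack (p : ℕ) (emin : ℤ) : ℤ → ℚ → List ℚ → Prop
  | _, _, [] => True
  | m, S, g :: rest => (∀ k : ℤ, ulp p emin g = (2 : ℚ) ^ k → ¬ OnGrid (k + 1) g →
      |S| < (2 : ℚ) ^ k / 2 - (2 : ℚ) ^ (m - 1)) ∧ UpSlack p emin (padicValRat 2 g) (S + g) rest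

/-- The valuation level reached after passing the list `l` from level `m`. -/
def slackLevel (m : ℤ) : List ℚ → ℤ
  | [] => m
  | a :: l => slackLevel (padicValRat 2 a) l

/-- Unfolding. -/
theorem downSlack_cons {g : ℚ} {rest : List ℚ} :
    DownSlack p emin (g :: rest) ↔ (∀ a ∈ rest.head?, ∀ k : ℤ, ulp p emin g = (2 : ℚ) ^ k →
      ¬ OnGrid (k + 1) g → |rest.sum| < (2 : ℚ) ^ k / 2 - (2 : ℚ) ^ (padicValRat 2 a - 1)) ∧
      DownSlack p emin rest := Iff.rfl

/-- Unfolding. -/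
theorem upSlack_cons {m : ℤ} {S g : ℚ} {rest : List ℚ} :
    UpSlack p emin m S (g :: rest) ↔ (∀ k : ℤ, ulp p emin g = (2 : ℚ) ^ k → ¬ OnGrid (k + 1) g →
      |S| < (2 : ℚ) ^ k / 2 - (2 : ℚ) ^ (m - 1)) ∧
      UpSlack p emin (padicValRat 2 g) (S + g) rest := Iff.rfl

/-- Lowering the level only weakens the slack condition. -/
theorem UpSlack.mono {m m' : ℤ} (hm : m' ≤ m) {S : ℚ} {l : List ℚ} (h : UpSlack p emin m S l) :
    UpSlack p emin m' S l := by
  cases l with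
  | nil => trivial
  | cons g rest =>
    refine ⟨fun k hk hodd => ?_, h.2⟩
    have h1 := h.1 k hk hodd
    have h2 : (2 : ℚ) ^ (m' - 1) ≤ (2 : ℚ) ^ (m - 1) := zpow_le_zpow_right₀ (by norm_num) (by omega)
    linarith

/-- The level after an appended component is its valuation. -/
theorem slackLevel_append_singleton (m : ℤ) (l : List ℚ) (x : ℚ) :
    slackLevel m (l ++ [x]) = padicValRat 2 x := by
  induction l generalizing m with
  | nil => rfl
  | cons a l ih => exact ih _

/-- The slack condition at an appended top component. -/
theorem upSlack_append_singleton {m : ℤ} {S : ℚ} {l : List ℚ} {d : ℚ} :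
    UpSlack p emin m S (l ++ [d]) ↔ UpSlack p emin m S l ∧ (∀ k : ℤ, ulp p emin d = (2 : ℚ) ^ k →
      ¬ OnGrid (k + 1) d → |S + l.sum| < (2 : ℚ) ^ k / 2 - (2 : ℚ) ^ (slackLevel m l - 1)) := by
  induction l generalizing m S with
  | nil => simp [UpSlack, slackLevel]
  | cons a l ih =>
    rw [List.cons_append, upSlack_cons, upSlack_cons, ih, slackLevel, List.sum_cons, ← add_assoc]
    tauto

/-- The two forms of the slack condition agree: from the downward form on `gs ++ [gb]` (largest
first) to the upward form over `gs.reverse`, starting from `gb`. -/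
theorem upSlack_of_downSlack (gb : ℚ) : ∀ gs : List ℚ, DownSlack p emin (gs ++ [gb]) →
    UpSlack p emin (padicValRat 2 gb) gb gs.reverse := by
  intro gs
  induction gs with
  | nil => intro _; trivial
  | cons g gs ih =>
    intro h
    rw [List.cons_append, downSlack_cons] at h
    rw [List.reverse_cons, upSlack_append_singleton]
    refine ⟨ih h.2, fun k hk hodd => ?_⟩
    cases gs with
    | nil =>
      have h1 := h.1 gb (by simp) k hk hodd
      simpa [slackLevel] using h1
    | cons x gs' =>
      have h1 := h.1 x (by simp) k hk hodd
      rw [List.reverse_cons, slackLevel_append_singleton]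
      have hs : gb + (gs'.reverse ++ [x]).sum = (x :: gs' ++ [gb]).sum := by
        simp [List.sum_reverse]; ring
      rw [hs]; exact h1

/-! ### Nonadjacency in valuations -/


/-- A number lying `c`-below `x` lies `c`-below every nonzero dyadic `w` at least as divisible. -/
theorem below_of_padicValRat_le {c z x w : ℚ} (h : Below c z x) (hx : x ≠ 0) {e : ℤ}
    (hw : OnGrid e w) (hw0 : w ≠ 0) (hv : padicValRat 2 x ≤ padicValRat 2 w) : Below c z w := by
  obtain ⟨s, hsx, hz⟩ := h
  exact ⟨s, (onGrid_padicValRat_two hw hw0).mono ((le_padicValRat_two_of_onGrid hsx hx).trans hv),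
    hz⟩

/-- Floats pairwise NONADJACENT (largest first) and nonadjacent below a nonzero dyadic `x` sum to
less than `2^(v x − 1)`. [cite: Shewchuk1997, §2.1 p. 309 (nonadjacent); Lemma 15 p. 320] -/
theorem abs_sum_lt_two_zpow_padicValRat_sub_one {x : ℚ} (hx0 : x ≠ 0) {xs : List ℚ}
    (hF : ∀ y ∈ xs, IsFloat p emin y) (hpw : xs.Pairwise (fun a b => Below 2 b a))
    (hbel : ∀ y ∈ xs, Below 2 y x) : |xs.sum| < (2 : ℚ) ^ (padicValRat 2 x - 1) := by
  have hexp : IsExpansion 1 xs.reverse :=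
    List.pairwise_reverse.mpr (hpw.imp fun h => h.anti (by norm_num))
  refine abs_sum_lt_two_zpow_of_rev hF hexp fun y hy => ?_
  obtain ⟨s, hsx, hys⟩ := hbel y hy
  have hs : (2 : ℚ) ^ s ≤ (2 : ℚ) ^ (padicValRat 2 x) :=
    zpow_le_zpow_right₀ (by norm_num) (le_padicValRat_two_of_onGrid hsx hx0)
  have e : (2 : ℚ) ^ (padicValRat 2 x) = 2 ^ (padicValRat 2 x - 1) * 2 := by
    rw [← zpow_add_one₀ (by norm_num : (2 : ℚ) ≠ 0), sub_add_cancel]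
  linarith

end Summit.Ventures.CertifiedArithmetic.Expansions
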